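import Summits.ResolutionOfSingularities.ResolutionOfSingularities.Theorems.FrobeniusLadderFInjectiveMacaulayficationCIConeFiModel
import Summits.ResolutionOfSingularities.ResolutionOfSingularities.Theorems.FrobeniusLadderFInjectiveMacaulayficationCISmoothChart
import Summits.ResolutionOfSingularities.ResolutionOfSingularities.Theorems.FrobeniusLadderFInjectiveMacaulayficationCIOrbitExpectedDim
import HarnessLib

/-!
# G5ᶜⁱ-smooth — the CI-CN engine on KHOVANSKII-SMOOTH charts: DATA ⇒ MODEL
# (crux `FInjectiveMacaulayfication`, CI-CN engine; seat res-L1-w45a-stub-1)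

[OURS · L1 W4.5a] Support file for crux stmt-ResolutionOfSingularities-15315. AI-written, weaker than expert review; no statement of
[claim: Hironaka2017] is used. `CIConeFiModel.ciConeFiModelRel` (the CI-CN glue, closed-centre form) asks, per chart `c` and per maximal
ideal `Q'` of the naive chart quotient `k[Y]/(g_c)` over `V(X_J)`, for the orbit binder AND the clause. On a chart whose strict transform
is SMOOTH along every torus orbit (the Khovanskii case — all realisable charts of the T-family specimens, K-T4), res-L1-w45a-stub-6's
SMOOTH-FACE CERTIFICATES (one per stratum `S ⊆ Fin n`: a monomial off `S` in `(g^S) + (coordinate r×r minors of g^S)`,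
`CISmoothChart.ci_clause_of_smoothFaceCertificate` p504573, `CIOrbitExpectedDim.isSMulRegular_X_of_smoothFaceCertificate` p505397)
produce both at EVERY prime of the chart. This file is that one-call composition:
* `quotientChartClause_of_smoothFaceCertificates` — per chart: certificates for the strata OVER `V(X_J)` (those `S` with
  `∀ j ∈ J, ∃ i ∈ S, V i j > 0`) ⇒ the `hon'` of `ciConeFiModelRel`;
* `ciConeFiModelRel_of_smoothFaceCertificates` — G5ᶜⁱ-smooth: the crux model for `Spec k[X]/(F₁, …, F_r)` from the monomial centre
  data (supported on `V(X_J)`), the chart data, the clause off `V(X_J)`, and ONE smooth-face certificate per (chart, stratum over `V(X_J)`) —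
  exactly the fields of stub-6's `KT4-DATA-FORMAT.md` v1.
No definitions, no named facts. [folklore]
-/

set_option linter.dupNamespace false

noncomputable section

open AlgebraicGeometry CategoryTheory Literature.AlgebraicGeometry.Resolution MvPolynomial

namespace Summit.ResolutionOfSingularities.ResolutionOfSingularities.Theorems.FInjectiveMacaulayfication.CIConeFiModelSmooth

open Summit.ResolutionOfSingularities.ResolutionOfSingularities.Theorems.FInjectiveMacaulayfication

/-- **Smooth-face certificates for the strata over `V(X_J)` ⇒ the per-chart hypothesis `hon'` of `CIConeFiModel.ciConeFiModelRel`**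
(a prime `Q' ∋ θ(X_j)` (`j ∈ J`) lies on a stratum `S` with `∀ j ∈ J, ∃ i ∈ S, V i j > 0`; orbit binder
by `CIOrbitExpectedDim.isSMulRegular_X_of_smoothFaceCertificate`, clause by `CISmoothChart.ci_clause_of_smoothFaceCertificate`, both at the
stratum `S(Q') = {i : Yᵢ ∈ Q'}`). [folklore] -/
theorem quotientChartClause_of_smoothFaceCertificates (p : ℕ) [Fact p.Prime] (k : Type) [Field k] [CharP k p] (n r : ℕ)
    (J : Finset (Fin n)) (V : Matrix (Fin n) (Fin n) ℕ) (g : Fin r → MvPolynomial (Fin n) k)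
    (hcert : ∀ S : Finset (Fin n), (∀ j ∈ J, ∃ i ∈ S, 0 < V i j) →
      ∃ (tt : ℕ) (js : Fin tt → Fin r → Fin n) (e : Fin n →₀ ℕ), (∀ i ∈ S, e i = 0) ∧
      (monomial e (1 : k) : MvPolynomial (Fin n) k) ∈
        Ideal.span (Set.range fun l : Fin r =>
            aeval (fun i : Fin n => if i ∈ S then (0 : MvPolynomial (Fin n) k) else X i) (g l)) ⊔
          Ideal.span (Set.range fun μ : Fin tt => (Matrix.of fun i l => pderiv (js μ i)
            (aeval (fun i : Fin n => if i ∈ S then (0 : MvPolynomial (Fin n) k) else X i) (g l))).det))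
    (Q' : Ideal (MvPolynomial (Fin n) k ⧸ Ideal.span (Set.range g))) [Q'.IsPrime]
    (hθ : ∀ j ∈ J, Ideal.Quotient.mk (Ideal.span (Set.range g))
      (aeval (fun j : Fin n => ∏ i : Fin n, (X i : MvPolynomial (Fin n) k) ^ V i j) (X j : MvPolynomial (Fin n) k)) ∈ Q') :
    (∀ i : Fin n, (X i : MvPolynomial (Fin n) k) ∈ Q'.comap (Ideal.Quotient.mk (Ideal.span (Set.range g))) →
      IsSMulRegular (Localization.AtPrime (Q'.comap (Ideal.Quotient.mk (Ideal.span (Set.range g)))) ⧸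
          (Ideal.span (Set.range g)).map (algebraMap (MvPolynomial (Fin n) k)
            (Localization.AtPrime (Q'.comap (Ideal.Quotient.mk (Ideal.span (Set.range g)))))))
        (algebraMap (MvPolynomial (Fin n) k) (Localization.AtPrime (Q'.comap (Ideal.Quotient.mk (Ideal.span (Set.range g))))) (X i))) ∧
    ∀ dd : ℕ, ringKrullDim (Localization.AtPrime Q') = dd → ∀ s : Fin dd → Localization.AtPrime Q',
      (Ideal.span (Set.range s)).radical.IsMaximal →
        RingTheory.Sequence.IsWeaklyRegular (Localization.AtPrime Q') (List.ofFn s) ∧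
        ∀ y : Localization.AtPrime Q', (∃ e : ℕ, y ^ p ^ e ∈ Ideal.span
          ((fun z : Localization.AtPrime Q' => z ^ p ^ e) ''
            (Ideal.span (Set.range s) : Set (Localization.AtPrime Q')))) → y ∈ Ideal.span (Set.range s) := by
  classical
  -- the stratum of `Q'`
  set S : Finset (Fin n) := Finset.univ.filter (fun i => Ideal.Quotient.mk (Ideal.span (Set.range g)) (X i) ∈ Q') with hSdef
  have hS : ∀ i : Fin n, i ∈ S ↔ Ideal.Quotient.mk (Ideal.span (Set.range g)) (X i) ∈ Q' := fun i => by
    rw [hSdef, Finset.mem_filter]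
    simp
  have hS' : ∀ i : Fin n, i ∈ S ↔ (X i : MvPolynomial (Fin n) k) ∈ Q'.comap (Ideal.Quotient.mk (Ideal.span (Set.range g))) :=
    fun i => by rw [hS, Ideal.mem_comap]
  -- the stratum covers `J`: `θ(X_j) = ∏ Yᵢ^(V i j) ∈ Q'` prime ⇒ some `Yᵢ ∈ Q'` with `V i j > 0`
  have hSJ : ∀ j ∈ J, ∃ i ∈ S, 0 < V i j := by
    intro j hj
    have h := hθ j hj
    rw [aeval_X, map_prod, Ideal.IsPrime.prod_mem_iff] at h
    obtain ⟨i, -, hi⟩ := h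
    rw [map_pow] at hi
    have hV : V i j ≠ 0 := by
      intro h0
      rw [h0, pow_zero] at hi
      exact (Ideal.IsPrime.ne_top ‹_›) ((Ideal.eq_top_iff_one _).mpr hi)
    exact ⟨i, (hS i).mpr (Ideal.IsPrime.mem_of_pow_mem ‹_› _ hi), Nat.pos_of_ne_zero hV⟩
  obtain ⟨tt, js, e, he, hc⟩ := hcert S hSJ
  haveI : (Q'.comap (Ideal.Quotient.mk (Ideal.span (Set.range g)))).IsPrime := Ideal.comap_isPrime _ _
  have hgs : ∀ l, g l ∈ Q'.comap (Ideal.Quotient.mk (Ideal.span (Set.range g))) := fun l => by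
    rw [Ideal.mem_comap]
    have h0 : Ideal.Quotient.mk (Ideal.span (Set.range g)) (g l) = 0 :=
      Ideal.Quotient.eq_zero_iff_mem.mpr (Ideal.subset_span (Set.mem_range_self l))
    rw [h0]
    exact Q'.zero_mem
  refine ⟨CIOrbitExpectedDim.isSMulRegular_X_of_smoothFaceCertificate g _ hgs S hS' tt js e he hc, ?_⟩
  exact (CISmoothChart.ci_clause_of_smoothFaceCertificate p k n r g Q' S hS tt js e he hc).2.2.1

/-- **G5ᶜⁱ-smooth `ciConeFiModelRel_of_smoothFaceCertificates` — DATA ⇒ MODEL on Khovanskii-smooth charts.** `CIConeFiModel.ciConeFiModelRel`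
with its per-chart `hon'` produced from ONE smooth-face certificate per (chart, stratum over `V(X_J)`) (stub-6's KT4-DATA-FORMAT v1 §(iii);
strata off `V(X_J)` need none — the points there are covered by `hoff`); remaining
non-data hypotheses: `(F)` prime, `x̄ⱼ ≠ 0`, and the clause off `V(X_J)`. [folklore] -/
theorem ciConeFiModelRel_of_smoothFaceCertificates (p : ℕ) [Fact p.Prime] (k : Type) [Field k] [CharP k p] (n : ℕ) (J : Finset (Fin n))
    (A : Finset (Fin n →₀ ℕ)) (hAJ : ∀ a ∈ A, ∃ j ∈ J, 0 < a j) (hprim : ∀ j ∈ J, ∃ N : ℕ, Finsupp.single j N ∈ A)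
    (t : ℕ) (ht : 0 < t) (m : Fin t → (Fin n →₀ ℕ)) (hm : ∀ c : Fin t, m c ∈ A)
    (hcov : ∀ a ∈ A, ∃ (c : Fin t) (K : ℕ), 1 ≤ K ∧ ∃ y ∈ (Ideal.span ((fun b : Fin n →₀ ℕ => (MvPolynomial.monomial b (1 : k) : MvPolynomial (Fin n) k)) '' (A : Set (Fin n →₀ ℕ)))) ^ (K - 1),
      (MvPolynomial.monomial a (1 : k) : MvPolynomial (Fin n) k) ^ K = MvPolynomial.monomial (m c) 1 * y)
    (V : Fin t → Matrix (Fin n) (Fin n) ℕ) (hV : ∀ c, IsUnit ((V c).map (Nat.cast : ℕ → ℤ)).det)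
    (a : Fin t → Fin n → (Fin n →₀ ℕ)) (haA : ∀ c i, a c i ∈ A)
    (hgen : ∀ (c : Fin t) (i : Fin n), (Finsupp.equivFunOnFinite.symm ((V c).mulVec ⇑(a c i)) : Fin n →₀ ℕ) =
      Finsupp.equivFunOnFinite.symm ((V c).mulVec ⇑(m c)) + Finsupp.single i 1)
    (hge : ∀ (c : Fin t), ∀ e ∈ A, (Finsupp.equivFunOnFinite.symm ((V c).mulVec ⇑(m c)) : Fin n →₀ ℕ) ≤
      Finsupp.equivFunOnFinite.symm ((V c).mulVec ⇑e))
    {r : ℕ} (Fs : Fin r → MvPolynomial (Fin n) k) (hprime : (Ideal.span (Set.range Fs)).IsPrime)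
    (hXne : ∀ v : Fin n, Ideal.Quotient.mk (Ideal.span (Set.range Fs)) (MvPolynomial.X v) ≠ 0)
    (hoff : ∀ (Q : Ideal (MvPolynomial (Fin n) k ⧸ Ideal.span (Set.range Fs))) [Q.IsMaximal],
      (∃ j ∈ J, Ideal.Quotient.mk (Ideal.span (Set.range Fs)) (MvPolynomial.X j) ∉ Q) →
      ∀ dd : ℕ, ringKrullDim (Localization.AtPrime Q) = dd → ∀ s : Fin dd → Localization.AtPrime Q,
        (Ideal.span (Set.range s)).radical.IsMaximal →
          RingTheory.Sequence.IsWeaklyRegular (Localization.AtPrime Q) (List.ofFn s) ∧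
          ∀ y : Localization.AtPrime Q, (∃ e : ℕ, y ^ p ^ e ∈ Ideal.span
            ((fun z : Localization.AtPrime Q => z ^ p ^ e) ''
              (Ideal.span (Set.range s) : Set (Localization.AtPrime Q)))) → y ∈ Ideal.span (Set.range s))
    (gs : Fin t → Fin r → MvPolynomial (Fin n) k) (d : Fin t → Fin r → (Fin n →₀ ℕ))
    (hθF : ∀ (c : Fin t) (l : Fin r), aeval (fun j : Fin n => ∏ i : Fin n, (X i : MvPolynomial (Fin n) k) ^ V c i j) (Fs l) =
      monomial (d c l) (1 : k) * gs c l)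
    (hunit : ∀ (c : Fin t) (l : Fin r), ∃ (N : ℕ) (r' : Fin n →₀ ℕ), N • m c = ∑ j : Fin n, d c l j • a c j + r')
    (hcert : (∀ (c : Fin t) (S : Finset (Fin n)), (∀ j ∈ J, ∃ i ∈ S, 0 < V c i j) →
      ∃ (tt : ℕ) (js : Fin tt → Fin r → Fin n) (e : Fin n →₀ ℕ), (∀ i ∈ S, e i = 0) ∧
      (monomial e (1 : k) : MvPolynomial (Fin n) k) ∈
        Ideal.span (Set.range fun l : Fin r =>
            aeval (fun i : Fin n => if i ∈ S then (0 : MvPolynomial (Fin n) k) else X i) (gs c l)) ⊔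
          Ideal.span (Set.range fun μ : Fin tt => (Matrix.of fun i l => pderiv (js μ i)
            (aeval (fun i : Fin n => if i ∈ S then (0 : MvPolynomial (Fin n) k) else X i) (gs c l))).det))) :
    ∃ (X' : Scheme.{0}) (π : X' ⟶ Spec (.of (MvPolynomial (Fin n) k ⧸ Ideal.span (Set.range Fs)))), IsProper π ∧
      Literature.AlgebraicGeometry.Resolution.IsBirational π ∧
      ∀ y : X', IsDomain (X'.presheaf.stalk y) ∧ ∀ dd : ℕ, ringKrullDim (X'.presheaf.stalk y) = dd →
        ∀ s : Fin dd → X'.presheaf.stalk y, (Ideal.span (Set.range s)).radical.IsMaximal →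
          RingTheory.Sequence.IsWeaklyRegular (X'.presheaf.stalk y) (List.ofFn s) ∧
          ∀ z : X'.presheaf.stalk y, (∃ e : ℕ, z ^ p ^ e ∈
              Ideal.span ((fun w : X'.presheaf.stalk y => w ^ p ^ e) ''
                (Ideal.span (Set.range s) : Set (X'.presheaf.stalk y)))) →
            z ∈ Ideal.span (Set.range s) :=
  CIConeFiModel.ciConeFiModelRel p k n J A hAJ hprim t ht m hm hcov V hV a haA hgen hge Fs hprime hXne hoff gs d hθF hunit
    (fun c Q' hmax hθ => by
      haveI := hmax.isPrime
      exact quotientChartClause_of_smoothFaceCertificates p k n r J (V c) (gs c) (hcert c) Q' hθ)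

end Summit.ResolutionOfSingularities.ResolutionOfSingularities.Theorems.FInjectiveMacaulayfication.CIConeFiModelSmooth

end
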